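import Mathlib.RingTheory.MvPolynomial.Basic
import Mathlib.FieldTheory.IsAlgClosed.AlgebraicClosure
import Mathlib.FieldTheory.Finite.Basic
import Mathlib.Analysis.SpecialFunctions.Pow.Real
import HarnessLib

/-!
# Effective Lang–Weil estimates for absolutely irreducible hypersurfaces over a finite field (Cafure–Matera 2006)

Topic `Literature/NumberTheory/DiophantineGeometry` (item `wi-17043`; wanted by the support item
`LangWeilBound` of route `ValiantsHypothesis/LangWeilTransfer`). Source read: A. Cafure,
G. Matera, *Improved explicit estimates on the number of solutions of equations over a finite
field*, Finite Fields Appl. 12 (2006) 155–185 (arXiv:math/0405302), verbatim: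

* §2: "An `𝔽_q`–variety `V ⊂ 𝔸ⁿ` is absolutely irreducible if it is irreducible as
  `𝔽̄_q`–variety." (`𝔸ⁿ = 𝔸ⁿ(𝔽̄_q)`; an `𝔽_q`-hypersurface of degree `δ` is the zero set of a
  polynomial `f ∈ 𝔽_q[X₁,…,Xₙ]` of degree `δ`, "the defining polynomial of `H`", proof of
  Thm. 5.4.) "**Lemma 2.1.** Let `V ⊂ 𝔸ⁿ` be an `𝔽_q`–variety of dimension `r ≥ 0` and degree
  `δ > 0`. Then the inequality `#(V ∩ 𝔽_qⁿ) ≤ δqʳ` holds. […] **Lemma 2.2.** Let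
  `f₁, …, f_s ∈ 𝔽_q[X₁,…,Xₙ]` (`s ≥ 2`) be nonzero polynomials of degree at most `δ > 0` without a
  common factor in `𝔽̄_q[X₁,…,Xₙ]`, and let `V ⊂ 𝔸ⁿ` be the `𝔽_q`–variety defined by
  `f₁, …, f_s`. Then `#(V ∩ 𝔽_qⁿ) ≤ δ²q^{n-2}`." (Proof: `V(f₁,f₂)` has dimension `n - 2` and
  degree `≤ δ²` by the Bézout inequality; then Lemma 2.1.)
* §5.1: "**Theorem 5.2.** For an absolutely irreducible `𝔽_q`–hypersurface `H` of `𝔸ⁿ` of degree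
  `δ` the following estimate holds:
  `|#(H ∩ 𝔽_qⁿ) - q^{n-1}| ≤ (δ-1)(δ-2)q^{n-3/2} + 5δ^{13/3}q^{n-2}`."
* §5.2: "**Theorem 5.4.** For `q > 2δ⁴`, any absolutely irreducible `𝔽_q`–hypersurface of degree
  `δ` has a `q`–rational zero." (Proof: an effective Bertini theorem, Cor. 3.4, gives an `𝔽_q`-plane
  section which is an absolutely irreducible plane curve of degree `δ`, and Weil's estimate
  `|#𝒞(𝔽_q) - q| ≤ (δ-1)(δ-2)√q + δ + 1` (1.2) leaves a point.)
* §7: "**Corollary 7.4.** For `q > max{2(r+1)δ², 2δ⁴}`, any absolutely irreducible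
  `𝔽_q`–variety `V` of dimension `r > 0` and degree `δ` has a `q`–rational point."

Background (quoted, not vendored): Lang–Weil 1954, Thm. 1 (`|#V(𝔽_q) - qʳ| ≤ (δ-1)(δ-2)q^{r-1/2} +
Cq^{r-1}`, ineffective `C`); W. M. Schmidt, *Equations over Finite Fields*, LNM 536, Ch. V Thm. 5A.

## Lean rendering

* `𝔽_q` is any finite field `K` (`[Field K] [Fintype K]`), `q = Fintype.card K`; the affine space is
  `Fin n → K`-valued points of `MvPolynomial (Fin n) K`.
* An `𝔽_q`-hypersurface of degree `δ` is entered through its defining polynomial `f`, with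
  `δ = f.totalDegree`; "absolutely irreducible" is `IsAbsIrreducible f`: `f` is irreducible in
  `𝔽̄_q[X₁,…,Xₙ]` (`MvPolynomial.map` to `AlgebraicClosure K`) — for a hypersurface `H = V(f)` with
  `f` absolutely irreducible (hence squarefree) this is the printed notion and `deg H = deg f`.
* `#(H ∩ 𝔽_qⁿ)` is `rationalPointCount f = #{x ∈ 𝔽_qⁿ : f(x) = 0}` (`Finset.filter`/`card`).
* Theorem 5.2 is an inequality of reals with the real powers `q^{n-3/2}`, `q^{n-2}`, `δ^{13/3}`
  (`Real.rpow`; for `n = 1` an absolutely irreducible `f` is linear and both sides read `0 ≤ …`).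
* Lemma 2.2 is vendored in the case `s = 2` used by its proof and by the route (two nonzero
  polynomials of degree `≤ δ` with no common factor in `𝔽̄_q[X]`, i.e. `IsRelPrime` after `map` to
  the algebraic closure): `#{f = g = 0} ≤ δ² q^{n-2}` in `ℕ` (for `n < 2` the exponent is the
  truncated `0` and the bound `δ²` is still true: coprime polynomials in `≤ 1` variable have no
  common zero); an instance of the printed lemma, never stronger. The mixed-degree bound
  `deg f · deg g · q^{n-2}` follows from the same proof (Bézout + Lemma 2.1) but is not printed and
  is NOT vendored.
* NOT vendored: Cor. 7.4 (needs `𝔽_q`-varieties of dimension `r` and their degree in the sense of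
  Heintz), Thm. 5.3, Thm. 5.7, §6 (polynomial systems).

## References

* [CafureMatera2006] A. Cafure, G. Matera, Improved explicit estimates on the number of solutions
  of equations over a finite field, Finite Fields Appl. 12 (2006) 155–185, Lemma 2.1, Lemma 2.2,
  Thm. 5.2, Thm. 5.4, Cor. 7.4.
* [LangWeil1954] S. Lang, A. Weil, Number of points of varieties in finite fields, Amer. J. Math.
  76 (1954) 819–827, Thm. 1.
* [Schmidt1976] W. M. Schmidt, Equations over Finite Fields: An Elementary Approach, LNM 536,
  Ch. V, Thm. 5A.
-/

noncomputable section

open MvPolynomial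

namespace Literature.NumberTheory.DiophantineGeometry

variable {K : Type*} [Field K] {n : ℕ}

/-- **Absolute irreducibility** of `f ∈ K[X₁,…,Xₙ]`: `f` is irreducible in `K̄[X₁,…,Xₙ]`, `K̄` an
algebraic closure of `K` ("An `𝔽_q`–variety is absolutely irreducible if it is irreducible as
`𝔽̄_q`–variety"; for the hypersurface `V(f)` this is irreducibility of its defining polynomial over
`𝔽̄_q`). [cite: CafureMatera2006, §2] -/
def IsAbsIrreducible (f : MvPolynomial (Fin n) K) : Prop :=
  Irreducible (MvPolynomial.map (algebraMap K (AlgebraicClosure K)) f)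

variable [Fintype K] [DecidableEq K]

/-- The number `#(H ∩ 𝔽_qⁿ)` of `𝔽_q`-rational points of the hypersurface `H = V(f)`: the number
of `x ∈ 𝔽_qⁿ` with `f(x) = 0`. [cite: CafureMatera2006, §2 (Lemma 2.1)] -/
def rationalPointCount (f : MvPolynomial (Fin n) K) : ℕ :=
  (Finset.univ.filter fun x : Fin n → K ↦ MvPolynomial.eval x f = 0).card

/-- The number of common `𝔽_q`-rational zeros `#(V(f, g) ∩ 𝔽_qⁿ)` of two polynomials.
[cite: CafureMatera2006, Lemma 2.2] -/
def commonZeroCount (f g : MvPolynomial (Fin n) K) : ℕ :=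
  (Finset.univ.filter fun x : Fin n → K ↦ MvPolynomial.eval x f = 0 ∧ MvPolynomial.eval x g = 0).card

/-- The trivial bound `#(H ∩ 𝔽_qⁿ) ≤ qⁿ`. [cite: CafureMatera2006, §2 (Lemma 2.1)] -/
theorem rationalPointCount_le (f : MvPolynomial (Fin n) K) :
    rationalPointCount f ≤ Fintype.card K ^ n := by
  unfold rationalPointCount
  exact (Finset.card_filter_le _ _).trans (by simp)

/-- Common zeros are zeros: `#(V(f,g) ∩ 𝔽_qⁿ) ≤ #(V(f) ∩ 𝔽_qⁿ)`. [cite: CafureMatera2006, Lemma 2.2] -/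
theorem commonZeroCount_le_rationalPointCount (f g : MvPolynomial (Fin n) K) :
    commonZeroCount f g ≤ rationalPointCount f := by
  unfold commonZeroCount rationalPointCount
  refine Finset.card_le_card fun x hx ↦ ?_
  simp only [Finset.mem_filter, Finset.mem_univ, true_and] at hx ⊢
  exact hx.1

/-- **Cafure–Matera (2006), Theorem 5.2 — effective Lang–Weil estimate for an absolutely irreducible
hypersurface, no regularity condition.** "For an absolutely irreducible `𝔽_q`–hypersurface `H` of
`𝔸ⁿ` of degree `δ` the following estimate holds:
`|#(H ∩ 𝔽_qⁿ) - q^{n-1}| ≤ (δ-1)(δ-2)q^{n-3/2} + 5δ^{13/3}q^{n-2}`." Rendering: `H = V(f)` for an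
absolutely irreducible `f ∈ 𝔽_q[X₁,…,Xₙ]` (`IsAbsIrreducible f`) with `δ = f.totalDegree`,
`q = #𝔽_q`, real powers. Statement only (proof, §3–5: effective Bertini/Kaltofen bounds on the
planes `L` with `f_L` not absolutely irreducible, Weil's estimate on the good plane sections, and an
averaging over the planes through a point). [cite: CafureMatera2006, Thm. 5.2] [cite: LangWeil1954, Thm. 1] -/
def CafureMatera2006_thm52 : Prop :=
  ∀ (K : Type) [Field K] [Fintype K] [DecidableEq K] (n : ℕ) (f : MvPolynomial (Fin n) K),
    IsAbsIrreducible f →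
      let q : ℝ := Fintype.card K
      let δ : ℝ := f.totalDegree
      |(rationalPointCount f : ℝ) - q ^ ((n : ℝ) - 1)| ≤
        (δ - 1) * (δ - 2) * q ^ ((n : ℝ) - 3 / 2) + 5 * δ ^ ((13 : ℝ) / 3) * q ^ ((n : ℝ) - 2)

/-- **Cafure–Matera (2006), Theorem 5.4 — rational points exist for `q > 2δ⁴`.** "For `q > 2δ⁴`, any
absolutely irreducible `𝔽_q`–hypersurface of degree `δ` has a `q`–rational zero." Rendering:
for an absolutely irreducible `f ∈ 𝔽_q[X₁,…,Xₙ]` with `2 δ⁴ < q`, `δ = f.totalDegree`, some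
`x ∈ 𝔽_qⁿ` has `f(x) = 0`. Statement only (proof: Cor. 3.4 gives a plane section that is an
absolutely irreducible plane curve of degree `δ`, and Weil's bound
`#𝒞(𝔽_q) ≥ q - (δ-1)(δ-2)√q - δ - 1 > 0`). [cite: CafureMatera2006, Thm. 5.4] -/
def CafureMatera2006_thm54 : Prop :=
  ∀ (K : Type) [Field K] [Fintype K] (n : ℕ) (f : MvPolynomial (Fin n) K),
    IsAbsIrreducible f → 2 * f.totalDegree ^ 4 < Fintype.card K →
      ∃ x : Fin n → K, MvPolynomial.eval x f = 0

/-- **Cafure–Matera (2006), Lemma 2.2 (case `s = 2`) — common zeros of coprime polynomials.**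
"Let `f₁, …, f_s ∈ 𝔽_q[X₁,…,Xₙ]` (`s ≥ 2`) be nonzero polynomials of degree at most `δ > 0` without a
common factor in `𝔽̄_q[X₁,…,Xₙ]` […]. Then `#(V ∩ 𝔽_qⁿ) ≤ δ²q^{n-2}`." Rendering for two
polynomials `f, g ≠ 0` of total degree `≤ δ`, `0 < δ`, relatively prime in `𝔽̄_q[X₁,…,Xₙ]`
(`IsRelPrime` of their images in `MvPolynomial (Fin n) (AlgebraicClosure K)`): the number of common
`𝔽_q`-zeros is `≤ δ² q^{n-2}` (natural numbers; for `n < 2` the exponent is `0`, see the module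
docstring). Statement only (proof: `dim V(f,g) = n - 2`, `deg V(f,g) ≤ δ²` by the Bézout inequality
(2.1), and Lemma 2.1 `#(V ∩ 𝔽_qⁿ) ≤ deg V · q^{dim V}`, itself from Heintz–Schnorr).
[cite: CafureMatera2006, Lemma 2.2 and Lemma 2.1] -/
def CafureMatera2006_lemma22 : Prop :=
  ∀ (K : Type) [Field K] [Fintype K] [DecidableEq K] (n δ : ℕ) (f g : MvPolynomial (Fin n) K),
    f ≠ 0 → g ≠ 0 → 0 < δ → f.totalDegree ≤ δ → g.totalDegree ≤ δ →
    IsRelPrime (MvPolynomial.map (algebraMap K (AlgebraicClosure K)) f)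
      (MvPolynomial.map (algebraMap K (AlgebraicClosure K)) g) →
      commonZeroCount f g ≤ δ ^ 2 * Fintype.card K ^ (n - 2)

/-! ### Small consequences (proved) -/

/-- Theorem 5.4 as a statement about the point count: for `q > 2δ⁴` the hypersurface has at least
one rational point. [cite: CafureMatera2006, Thm. 5.4] -/
theorem CafureMatera2006_thm54.rationalPointCount_pos (h : CafureMatera2006_thm54)
    {K : Type} [Field K] [Fintype K] [DecidableEq K] {n : ℕ} {f : MvPolynomial (Fin n) K}
    (hf : IsAbsIrreducible f) (hq : 2 * f.totalDegree ^ 4 < Fintype.card K) :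
    0 < rationalPointCount f := by
  obtain ⟨x, hx⟩ := h K n f hf hq
  exact Finset.card_pos.2 ⟨x, by simp [hx]⟩

/-- Theorem 5.2's lower half: `#(H ∩ 𝔽_qⁿ) ≥ q^{n-1} - (δ-1)(δ-2)q^{n-3/2} - 5δ^{13/3}q^{n-2}`.
[cite: CafureMatera2006, Thm. 5.2] -/
theorem CafureMatera2006_thm52.lower (h : CafureMatera2006_thm52)
    {K : Type} [Field K] [Fintype K] [DecidableEq K] {n : ℕ} {f : MvPolynomial (Fin n) K}
    (hf : IsAbsIrreducible f) :
    (Fintype.card K : ℝ) ^ ((n : ℝ) - 1) -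
        (((f.totalDegree : ℝ) - 1) * ((f.totalDegree : ℝ) - 2) * (Fintype.card K : ℝ) ^ ((n : ℝ) - 3 / 2) +
          5 * (f.totalDegree : ℝ) ^ ((13 : ℝ) / 3) * (Fintype.card K : ℝ) ^ ((n : ℝ) - 2)) ≤
      rationalPointCount f := by
  have := h K n f hf
  simp only at this
  have h1 := (abs_le.1 this).1
  linarith

/-- Theorem 5.2's upper half: `#(H ∩ 𝔽_qⁿ) ≤ q^{n-1} + (δ-1)(δ-2)q^{n-3/2} + 5δ^{13/3}q^{n-2}`.
[cite: CafureMatera2006, Thm. 5.2] -/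
theorem CafureMatera2006_thm52.upper (h : CafureMatera2006_thm52)
    {K : Type} [Field K] [Fintype K] [DecidableEq K] {n : ℕ} {f : MvPolynomial (Fin n) K}
    (hf : IsAbsIrreducible f) :
    (rationalPointCount f : ℝ) ≤ (Fintype.card K : ℝ) ^ ((n : ℝ) - 1) +
        (((f.totalDegree : ℝ) - 1) * ((f.totalDegree : ℝ) - 2) * (Fintype.card K : ℝ) ^ ((n : ℝ) - 3 / 2) +
          5 * (f.totalDegree : ℝ) ^ ((13 : ℝ) / 3) * (Fintype.card K : ℝ) ^ ((n : ℝ) - 2)) := by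
  have := h K n f hf
  simp only at this
  have h1 := (abs_le.1 this).2
  linarith

end Literature.NumberTheory.DiophantineGeometry

end
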